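import Literature.AlgebraicTopology.KTheory.BottLinear
import Literature.AlgebraicTopology.KTheory.BottSpectral
import Mathlib.Analysis.SpecialFunctions.Trigonometric.Basic
import HarnessLib

/-!
# Bott periodicity, surjectivity half: `K⁰(X × S²) = pr₁^*K⁰(X) + pr₁^*K⁰(X)·γ` (Husemöller, *Fibre Bundles*, Ch. 11 §§2–5)

For a compact Hausdorff space `X`, with `γ = [θ¹, z] ∈ K⁰(X × S²)` (`bottγ`, the class clutched
from the trivial line bundle by `z`) and `η = [θ¹, z̄]` (`bottη`):

* `bottγ_mul_bottη : γ η = 1`, `bottγ_sq_add_one : γ² + 1 = 2γ` (so `(γ - 1)² = 0`), via the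
  product formula for clutched classes of line bundles and the rotation homotopy;
* GL Laurent approximation `exists_laurentMatrix_bottClassGL_eq` (every `[θ, g]` is `[θ, L]` for
  an invertible matrix Laurent polynomial `L`), the passage to polynomials
  `zA_pow_smul_laurentMatrix : zˢ L = p` (`laurentShift`, `laurentDeg`, `laurentCoeff`) with
  `[θ, L] = [θ, p] ηˢ`, the identification `comp_Lmat_eq_linClutch` of the linearisation
  `Lᵐ(p)` with a linear clutching matrix `z·linA + linB a` over `X`;
* the subgroup `InPhi ξ :↔ ∃ α β, ξ = pr₁^*α + pr₁^*β·γ` is closed under the above reductions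
  (`InPhi.of_linClutch/of_polyClutch/of_laurent/of_bottClassGL/of_idem`), whence
  **`bott_surjective : ∀ ξ : K⁰(X × S²), ∃ α β : K⁰(X), ξ = pr₁^*α + pr₁^*β·γ`**
  (Husemöller 11 Thm. 5.1/Cor. 5.2, surjectivity of the Bott map).

Everything is proved; no named facts. The injectivity half (index map) is in `BottIndex*.lean`.

## References

* D. Husemöller, *Fibre Bundles*, 3rd ed. (1994) [HusemollerFibreBundles1994]: Ch. 11 §2
  (Props. 2.5–2.6, Cor. 2.8), §3 (Prop. 3.2), §4 (Props. 4.6–4.7), §5 (Notation 5.1, Thm. 5.1).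
-/

noncomputable section

open Set Metric unitInterval Complex

namespace Literature.AlgebraicTopology.KTheory

open Literature.RingTheory.KTheory Matrix Pencil Linearization Kronecker

universe u

variable {X : Type u} [TopologicalSpace X]
variable {ι : Type} [Fintype ι] [DecidableEq ι]

/-! ### Kronecker products of clutching matrices: `[θ, g ⊗ g'] = [θ, g] · [θ, g']` -/

/-- Kronecker products of GL-clutched idempotents. [cite: HusemollerFibreBundles1994, Ch. 10 Prop. 1.5] -/
theorem IsClutchedGL.kronecker {m m' ι' : Type*} [Fintype m] [Fintype m'] [Fintype ι'] [DecidableEq ι']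
    {Q : Matrix m m C(X × S2r, ℂ)} {Q' : Matrix m' m' C(X × S2r, ℂ)}
    {g : Matrix ι ι C(↥(pieceUp X ∩ pieceDn X), ℂ)} {g' : Matrix ι' ι' C(↥(pieceUp X ∩ pieceDn X), ℂ)}
    (h : IsClutchedGL Q g) (h' : IsClutchedGL Q' g') : IsClutchedGL (Q ⊗ₖ Q') (g ⊗ₖ g') := by
  obtain ⟨w, hw⟩ := h
  obtain ⟨w', hw'⟩ := h'
  refine ⟨(w.kronecker w').castModels Matrix.one_kronecker_one Matrix.one_kronecker_one, ?_⟩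
  rw [GluingWitness.g_castModels, GluingWitness.g_kronecker, hw, hw']

variable [CompactSpace X] [T2Space X]

/-- **`[θ, g ⊗ g'] = [θ, g] · [θ, g']`** in the ring `K⁰(X × S²)`. [cite: HusemollerFibreBundles1994, Ch. 10 Prop. 1.5] -/
theorem bottClassGL_kronecker {ι' : Type} [Fintype ι'] [DecidableEq ι'] (g : Matrix ι ι C(↥(pieceUp X ∩ pieceDn X), ℂ))
    (g' : Matrix ι' ι' C(↥(pieceUp X ∩ pieceDn X), ℂ)) (hg : IsUnit g) (hg' : IsUnit g') :
    bottClassGL (g ⊗ₖ g') = bottClassGL g * bottClassGL g' := by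
  obtain ⟨q, hq⟩ := exists_idem_isClutchedGL g hg
  obtain ⟨q', hq'⟩ := exists_idem_isClutchedGL g' hg'
  have hk : IsClutchedGL (q * q').mat (g ⊗ₖ g') := (hq.kronecker hq').reindex _
  rw [← hk.of_eq, ← KZero.of_mul_of, hq.of_eq, hq'.of_eq]

omit [CompactSpace X] [T2Space X] [Fintype ι] [DecidableEq ι] in
/-- A scalar multiple is a Kronecker product with a `1 × 1` matrix (up to re-indexing). [folklore] -/
theorem smul_eq_reindex_kronecker {R : Type*} [CommRing R] (f : R) (g : Matrix ι ι R) :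
    f • g = Matrix.reindex (Equiv.prodUnique ι (Fin 1)) (Equiv.prodUnique ι (Fin 1)) (g ⊗ₖ (f • (1 : Matrix (Fin 1) (Fin 1) R))) := by
  ext i j
  simp [mul_comm]

/-- **Scalar twist**: `[θ, f g] = [θ, g] · [θ¹, f]` for a unit scalar `f` (Husemöller 11 Cor. 2.8:
`[ζ, zⁿu] = [ζ,u] ⊗ γⁿ`). [cite: HusemollerFibreBundles1994, Ch. 11 Cor. 2.8] -/
theorem bottClassGL_smul (f : C(↥(pieceUp X ∩ pieceDn X), ℂ)) (hf : IsUnit f) (g : Matrix ι ι C(↥(pieceUp X ∩ pieceDn X), ℂ))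
    (hg : IsUnit g) : bottClassGL (f • g) = bottClassGL g * bottClassGL (f • (1 : Matrix (Fin 1) (Fin 1) C(↥(pieceUp X ∩ pieceDn X), ℂ))) := by
  have h1 : IsUnit (f • (1 : Matrix (Fin 1) (Fin 1) C(↥(pieceUp X ∩ pieceDn X), ℂ))) := by
    rw [← Algebra.algebraMap_eq_smul_one]; exact hf.map _
  rw [smul_eq_reindex_kronecker, bottClassGL_reindex, bottClassGL_kronecker g _ hg h1]

/-- Unit scalars give unit `1 × 1` matrices. [folklore] -/
theorem isUnit_smul_one {R : Type*} [CommRing R] {f : R} (hf : IsUnit f) (κ : Type*) [Fintype κ] [DecidableEq κ] :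
    IsUnit (f • (1 : Matrix κ κ R)) := by
  rw [← Algebra.algebraMap_eq_smul_one]; exact hf.map _

/-- Unit scalars times unit matrices are units. [folklore] -/
theorem isUnit_smul_of_isUnit {R : Type*} [CommRing R] {f : R} (hf : IsUnit f) {κ : Type*} [Fintype κ] [DecidableEq κ]
    {g : Matrix κ κ R} (hg : IsUnit g) : IsUnit (f • g) := by
  rw [← smul_one_mul]; exact (isUnit_smul_one hf κ).mul hg

/-! ### The classes `γ = [θ¹, z]` and `η = [θ¹, z⁻¹]` -/

omit [CompactSpace X] [T2Space X] [Fintype ι] [DecidableEq ι] in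
/-- Auxiliary statement for the surjectivity half of Bott periodicity. [folklore] -/
theorem isUnit_zA : IsUnit (zA : C(↥(pieceUp X ∩ pieceDn X), ℂ)) := ⟨zU, rfl⟩

omit [CompactSpace X] [T2Space X] [Fintype ι] [DecidableEq ι] in
/-- Auxiliary statement for the surjectivity half of Bott periodicity. [folklore] -/
theorem isUnit_zAbar : IsUnit (zAbar : C(↥(pieceUp X ∩ pieceDn X), ℂ)) := ⟨zU⁻¹, rfl⟩

variable (X) in
/-- **`γ = [θ¹, z] ∈ K⁰(X × S²)`** (the dual Hopf bundle pulled back to `X × S²`). [cite: HusemollerFibreBundles1994, Ch. 11 Example 2.4] -/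
def bottγ : K0 (X × S2r) := bottClassGL ((zA : C(↥(pieceUp X ∩ pieceDn X), ℂ)) • (1 : Matrix (Fin 1) (Fin 1) C(↥(pieceUp X ∩ pieceDn X), ℂ)))

variable (X) in
/-- **`η = [θ¹, z⁻¹] ∈ K⁰(X × S²)`** (the Hopf bundle `H`, Husemöller 11 Example 2.4). [cite: HusemollerFibreBundles1994, Ch. 11 Example 2.4] -/
def bottη : K0 (X × S2r) := bottClassGL ((zAbar : C(↥(pieceUp X ∩ pieceDn X), ℂ)) • (1 : Matrix (Fin 1) (Fin 1) C(↥(pieceUp X ∩ pieceDn X), ℂ)))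

/-- `γ η = 1`. [cite: HusemollerFibreBundles1994, Ch. 11 Example 2.4] -/
theorem bottγ_mul_bottη : bottγ X * bottη X = 1 := by
  rw [bottγ, bottη, ← bottClassGL_smul _ isUnit_zAbar _ (isUnit_smul_one isUnit_zA _), smul_smul, zAbar_mul_zA, one_smul,
    bottClassGL_one]
  simp

/-- `[θ, zᵏ g] = [θ, g] γᵏ`. [cite: HusemollerFibreBundles1994, Ch. 11 Cor. 2.8] -/
theorem bottClassGL_zA_pow_smul (k : ℕ) (g : Matrix ι ι C(↥(pieceUp X ∩ pieceDn X), ℂ)) (hg : IsUnit g) :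
    bottClassGL ((zA : C(↥(pieceUp X ∩ pieceDn X), ℂ)) ^ k • g) = bottClassGL g * bottγ X ^ k := by
  induction k with
  | zero => rw [pow_zero, one_smul, pow_zero, mul_one]
  | succ k ih =>
    rw [pow_succ', mul_smul, bottClassGL_smul _ isUnit_zA _ (isUnit_smul_of_isUnit (isUnit_zA.pow k) hg), ih, pow_succ, mul_assoc]
    rfl

/-! ### The rotation homotopy: `γ² + 1 = 2γ` -/

section Rotation

/-- `cos(π s / 2)` on `(X × [0,1]) × S¹`. [folklore] -/
def cRot : C(↥(pieceUp (X × I) ∩ pieceDn (X × I)), ℂ) :=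
  ⟨fun z ↦ (Real.cos (Real.pi * (z.1.1.2 : ℝ) / 2) : ℂ), by fun_prop⟩

/-- `sin(π s / 2)` on `(X × [0,1]) × S¹`. [folklore] -/
def sRot : C(↥(pieceUp (X × I) ∩ pieceDn (X × I)), ℂ) :=
  ⟨fun z ↦ (Real.sin (Real.pi * (z.1.1.2 : ℝ) / 2) : ℂ), by fun_prop⟩

omit [CompactSpace X] [T2Space X] in
/-- Auxiliary statement for the surjectivity half of Bott periodicity. [folklore] -/
@[simp] theorem cRot_apply (z : ↥(pieceUp (X × I) ∩ pieceDn (X × I))) : cRot z = (Real.cos (Real.pi * (z.1.1.2 : ℝ) / 2) : ℂ) := rfl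
omit [CompactSpace X] [T2Space X] in
/-- Auxiliary statement for the surjectivity half of Bott periodicity. [folklore] -/
@[simp] theorem sRot_apply (z : ↥(pieceUp (X × I) ∩ pieceDn (X × I))) : sRot z = (Real.sin (Real.pi * (z.1.1.2 : ℝ) / 2) : ℂ) := rfl

omit [CompactSpace X] [T2Space X] in
/-- Auxiliary statement for the surjectivity half of Bott periodicity. [folklore] -/
theorem cRot_sq_add_sRot_sq : (cRot : C(↥(pieceUp (X × I) ∩ pieceDn (X × I)), ℂ)) ^ 2 + sRot ^ 2 = 1 := by
  ext z
  simp only [ContinuousMap.add_apply, ContinuousMap.pow_apply, cRot_apply, sRot_apply, ContinuousMap.one_apply]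
  rw [← Complex.ofReal_pow, ← Complex.ofReal_pow, ← Complex.ofReal_add, Real.cos_sq_add_sin_sq, Complex.ofReal_one]

/-- **The rotation homotopy** `diag(z,1) R_s diag(1,z) R_s⁻¹` from `diag(z, z)` (`s = 0`) to
`diag(z², 1)` (`s = 1`), in closed form. [cite: HusemollerFibreBundles1994, Ch. 11 Example 2.4] -/
def rotHomotopy : Matrix (Fin 2) (Fin 2) C(↥(pieceUp (X × I) ∩ pieceDn (X × I)), ℂ) :=
  !![zA' * cRot ^ 2 + zA' ^ 2 * sRot ^ 2, zA' * cRot * sRot * (1 - zA');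
    sRot * cRot * (1 - zA'), sRot ^ 2 + zA' * cRot ^ 2]

omit [CompactSpace X] [T2Space X] in
/-- Auxiliary statement for the surjectivity half of Bott periodicity. [folklore] -/
theorem det_rotHomotopy : (rotHomotopy (X := X)).det = zA' ^ 2 := by
  rw [rotHomotopy, Matrix.det_fin_two_of]
  have h := cRot_sq_add_sRot_sq (X := X)
  linear_combination (zA' (X := X)) ^ 2 * (cRot ^ 2 + sRot ^ 2 + 1) * h

omit [CompactSpace X] [T2Space X] in
/-- Auxiliary statement for the surjectivity half of Bott periodicity. [folklore] -/
theorem isUnit_rotHomotopy : IsUnit (rotHomotopy (X := X)) := by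
  rw [Matrix.isUnit_iff_isUnit_det, det_rotHomotopy]
  exact (isUnit_zA (X := X × I)).pow 2

omit [CompactSpace X] [T2Space X] in
/-- Auxiliary statement for the surjectivity half of Bott periodicity. [folklore] -/
@[simp] theorem zA'_sliceOverlap (t : I) (z : ↥(pieceUp X ∩ pieceDn X)) : zA' (sliceOverlap t z) = zA z := rfl

omit [CompactSpace X] [T2Space X] in
/-- At `s = 0` the rotation homotopy is `diag(z, z)`. [folklore] -/
theorem rotHomotopy_slice_zero :
    (rotHomotopy (X := X)).map (comapRingHom (sliceOverlap 0)) = !![(zA : C(↥(pieceUp X ∩ pieceDn X), ℂ)), 0; 0, zA] := by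
  ext i j z
  fin_cases i <;> fin_cases j <;> simp [rotHomotopy, Matrix.map_apply]

omit [CompactSpace X] [T2Space X] in
/-- At `s = 1` the rotation homotopy is `diag(z², 1)`. [folklore] -/
theorem rotHomotopy_slice_one :
    (rotHomotopy (X := X)).map (comapRingHom (sliceOverlap 1)) = !![(zA : C(↥(pieceUp X ∩ pieceDn X), ℂ)) ^ 2, 0; 0, 1] := by
  ext i j z
  fin_cases i <;> fin_cases j <;> simp [rotHomotopy, Matrix.map_apply]

omit [CompactSpace X] [T2Space X] in
/-- A diagonal `2 × 2` matrix is a re-indexed block sum of `1 × 1` blocks. [folklore] -/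
theorem diag_two_eq_reindex_fromBlocks {R : Type*} [CommRing R] (a b : R) :
    !![a, 0; 0, b] = Matrix.reindex finSumFinEquiv finSumFinEquiv (Matrix.fromBlocks !![a] 0 0 !![b]) := by
  ext i j
  fin_cases i <;> fin_cases j <;> rfl

omit [CompactSpace X] [T2Space X] in
/-- Auxiliary statement for the surjectivity half of Bott periodicity. [folklore] -/
theorem one_one_eq_smul_one {R : Type*} [CommRing R] (a : R) : !![a] = a • (1 : Matrix (Fin 1) (Fin 1) R) := by
  ext i j; fin_cases i; fin_cases j; simp

/-- **`γ² + 1 = 2γ` in `K⁰(X × S²)`** (Husemöller 11 Example 2.4: `H² ⊕ 1 ≅ H ⊕ H` via the rotation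
homotopy `diag(z², 1) ≃ diag(z, z)`). [cite: HusemollerFibreBundles1994, Ch. 11 Example 2.4] -/
theorem bottγ_sq_add_one : bottγ X ^ 2 + 1 = 2 * bottγ X := by
  have hz : IsUnit (zA : C(↥(pieceUp X ∩ pieceDn X), ℂ)) := isUnit_zA
  have hhom := bottClassGL_eq_of_homotopy _ _ (rotHomotopy (X := X)) isUnit_rotHomotopy rotHomotopy_slice_zero rotHomotopy_slice_one
  rw [diag_two_eq_reindex_fromBlocks, diag_two_eq_reindex_fromBlocks, bottClassGL_reindex, bottClassGL_reindex,
    bottClassGL_fromBlocks _ _ (by rw [one_one_eq_smul_one]; exact isUnit_smul_one hz _) (by rw [one_one_eq_smul_one]; exact isUnit_smul_one hz _),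
    bottClassGL_fromBlocks _ _ (by rw [one_one_eq_smul_one]; exact isUnit_smul_one (hz.pow 2) _)
      (by rw [one_one_eq_smul_one, one_smul]; exact isUnit_one),
    one_one_eq_smul_one, one_one_eq_smul_one, one_one_eq_smul_one, one_smul, bottClassGL_one] at hhom
  have hsq : bottClassGL ((zA : C(↥(pieceUp X ∩ pieceDn X), ℂ)) ^ 2 • (1 : Matrix (Fin 1) (Fin 1) C(↥(pieceUp X ∩ pieceDn X), ℂ))) =
      bottγ X ^ 2 := by
    rw [bottClassGL_zA_pow_smul 2 _ isUnit_one, bottClassGL_one]; simp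
  rw [hsq, Fintype.card_fin, Nat.cast_one] at hhom
  rw [← hhom, bottγ, two_mul]

/-- `η = 2 - γ`. [cite: HusemollerFibreBundles1994, Ch. 11 Example 2.4] -/
theorem bottη_eq : bottη X = 2 - bottγ X := by
  have h1 := bottγ_mul_bottη (X := X)
  have h2 := bottγ_sq_add_one (X := X)
  have : bottγ X * (2 - bottγ X) = 1 := by linear_combination -h2
  calc bottη X = (bottγ X * (2 - bottγ X)) * bottη X := by rw [this, one_mul]
    _ = (2 - bottγ X) * (bottγ X * bottη X) := by ring
    _ = 2 - bottγ X := by rw [h1, mul_one]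

end Rotation

/-! ### `[ζ, z] = pr₁^*[ζ] · γ` -/

omit [CompactSpace X] [T2Space X] [Fintype ι] [DecidableEq ι] in
/-- `M ⊗ (f · 1₁)` re-indexed along `ι × Fin 1 ≃ ι` is `f • M`. [folklore] -/
theorem reindex_kronecker_smul_one {R : Type*} [CommRing R] {κ : Type*} (M : Matrix κ κ R) (f : R) :
    Matrix.reindex (Equiv.prodUnique κ (Fin 1)) (Equiv.prodUnique κ (Fin 1)) (M ⊗ₖ (f • (1 : Matrix (Fin 1) (Fin 1) R))) = f • M := by
  ext i j; simp [mul_comm]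

omit [CompactSpace X] [T2Space X] [Fintype ι] [DecidableEq ι] in
/-- Auxiliary statement for the surjectivity half of Bott periodicity. [folklore] -/
theorem reindex_kronecker_one_one {R : Type*} [CommRing R] {κ : Type*} (M : Matrix κ κ R) :
    Matrix.reindex (Equiv.prodUnique κ (Fin 1)) (Equiv.prodUnique κ (Fin 1)) (M ⊗ₖ (1 : Matrix (Fin 1) (Fin 1) R)) = M := by
  ext i j; simp

omit [T2Space X] [Fintype ι] [DecidableEq ι] in
/-- **`[ζ, z]` is clutched from `pr₁^*ζ ⊗ [θ¹, z]`.** [cite: HusemollerFibreBundles1994, Ch. 11 Cor. 2.8] -/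
theorem IsClutched.zClutch_of_kronecker {m m' : Type*} [Fintype m] [Fintype m'] {ζ : Idem C(X, ℂ)} {Q : Matrix m m C(X × S2r, ℂ)}
    {Q' : Matrix m' m' C(X × S2r, ℂ)} (hQ : IsClutched Q ζ (ClutchingFn.one ζ))
    (hQ' : IsClutchedGL Q' ((zA : C(↥(pieceUp X ∩ pieceDn X), ℂ)) • (1 : Matrix (Fin 1) (Fin 1) C(↥(pieceUp X ∩ pieceDn X), ℂ)))) :
    IsClutched (Q ⊗ₖ Q') ζ (zClutch ζ) := by
  obtain ⟨w, hw⟩ := hQ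
  obtain ⟨w', hw'⟩ := hQ'
  refine ⟨((w.kronecker w').reindexModels (Equiv.prodUnique _ (Fin 1)) (Equiv.prodUnique _ (Fin 1))).castModels
    (reindex_kronecker_one_one _) (reindex_kronecker_one_one _), ?_⟩
  rw [GluingWitness.g_castModels, GluingWitness.g_reindexModels, GluingWitness.g_kronecker, hw, hw', reindex_kronecker_smul_one]
  rfl

/-- **`[ζ, z] = pr₁^*[ζ] · γ`** in `K⁰(X × S²)` (Husemöller 11 Cor. 2.8 with `n = 1`). [cite: HusemollerFibreBundles1994, Ch. 11 Cor. 2.8] -/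
theorem bottClass_zClutch (ζ : Idem C(X, ℂ)) : bottClass ζ (zClutch ζ) = pullback (prX X) (KZero.of ζ) * bottγ X := by
  have hq : IsClutched (ζ.map (comapRingHom (prX X))).mat ζ (ClutchingFn.one ζ) := isClutched_map_prX ζ
  obtain ⟨q', hq'⟩ := exists_idem_isClutchedGL ((zA : C(↥(pieceUp X ∩ pieceDn X), ℂ)) • (1 : Matrix (Fin 1) (Fin 1) _))
    (isUnit_smul_one isUnit_zA _)
  have hk : IsClutched (ζ.map (comapRingHom (prX X)) * q').mat ζ (zClutch ζ) := (hq.zClutch_of_kronecker hq').reindex _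
  rw [← hk.of_eq, ← KZero.of_mul_of, pullback_of, bottγ, hq'.of_eq]

/-! ### Invertible matrices as clutching functions of the trivial bundle; GL Laurent approximation -/

section GLLaurent

variable {n : ℕ}

variable (X) in
/-- The trivial idempotent `θₙ` with *reducible* size `n` (definitionally `Idem.unit n`). [folklore] -/
abbrev trivIdem (n : ℕ) : Idem C(X, ℂ) := ⟨n, 1, IsIdempotentElem.one⟩

omit [CompactSpace X] [T2Space X] [Fintype ι] [DecidableEq ι] in
/-- Auxiliary statement for the surjectivity half of Bott periodicity. [folklore] -/
theorem trivIdem_eq_unit : trivIdem X n = Idem.unit n := rfl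

omit [CompactSpace X] [T2Space X] [Fintype ι] [DecidableEq ι] in
/-- Auxiliary statement for the surjectivity half of Bott periodicity. [folklore] -/
theorem pullA_trivIdem : pullA (trivIdem X n) = 1 := Matrix.map_one _ (map_zero _) (map_one _)

omit [T2Space X] [Fintype ι] [DecidableEq ι] in
/-- An invertible matrix over `X × S¹` is a clutching function of the trivial bundle `θₙ`. [cite: HusemollerFibreBundles1994, Ch. 11 Notation 2.7] -/
def ClutchingFn.ofUnitGL (g : Matrix (Fin n) (Fin n) C(↥(pieceUp X ∩ pieceDn X), ℂ)) (hg : IsUnit g) : ClutchingFn (trivIdem X n) where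
  u := g
  v := ((hg.unit⁻¹ : (Matrix (Fin n) (Fin n) C(↥(pieceUp X ∩ pieceDn X), ℂ))ˣ) : Matrix (Fin n) (Fin n) _)
  hu := by rw [pullA_trivIdem, Matrix.one_mul, Matrix.mul_one]
  hv := by rw [pullA_trivIdem, Matrix.one_mul, Matrix.mul_one]
  huv := by rw [pullA_trivIdem]; exact hg.mul_val_inv
  hvu := by rw [pullA_trivIdem]; exact hg.val_inv_mul

omit [CompactSpace X] [T2Space X] [Fintype ι] [DecidableEq ι] in
/-- Auxiliary statement for the surjectivity half of Bott periodicity. [folklore] -/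
theorem ClutchingFn.ext_of_triv (c : ClutchingFn (trivIdem X n)) : c.ext = c.u := by
  rw [ClutchingFn.ext, pullA_trivIdem, sub_self, add_zero]

omit [CompactSpace X] [T2Space X] [Fintype ι] [DecidableEq ι] in
/-- The complement of the trivial idempotent has class zero. [folklore] -/
theorem of_compl_triv : KZero.of (trivIdem X n).compl = 0 := by
  rw [← KZero.of_zero]
  apply KZero.of_eq_of
  refine ⟨0, 0, ?_, ?_, ?_, ?_⟩
  · rw [Matrix.mul_zero]; exact (sub_self _).symm
  · rw [Matrix.mul_zero]; rfl
  · simp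
  · simp

omit [Fintype ι] [DecidableEq ι] in
/-- `[θ, g] = [θₙ, g]` as a clutching function of the trivial idempotent. [cite: HusemollerFibreBundles1994, Ch. 11 Notation 2.7] -/
theorem bottClass_triv_eq (c : ClutchingFn (trivIdem X n)) : bottClass (trivIdem X n) c = bottClassGL c.u := by
  have h := bottClass_add_pullback_compl c
  rwa [of_compl_triv, map_zero, add_zero, c.ext_of_triv] at h

omit [Fintype ι] [DecidableEq ι] in
/-- **GL Laurent approximation**: every invertible matrix over `X × S¹` has the Bott class of an
invertible matrix Laurent polynomial `∑ᵢ z^{eᵢ} Aᵢ(x)`. [cite: HusemollerFibreBundles1994, Ch. 11 Prop. 2.6] -/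
theorem exists_laurentMatrix_bottClassGL_eq (g : Matrix (Fin n) (Fin n) C(↥(pieceUp X ∩ pieceDn X), ℂ)) (hg : IsUnit g) :
    ∃ (ι' : Type) (_ : Fintype ι') (A : ι' → Matrix (Fin n) (Fin n) C(X, ℂ)) (e : ι' → ℤ),
      IsUnit (laurentMatrix A e) ∧ bottClassGL g = bottClassGL (laurentMatrix A e) := by
  obtain ⟨ι', _, A, e, c', hc'u, hc'⟩ := (ClutchingFn.ofUnitGL g hg).exists_laurent_bottClass_eq
  have hu : c'.u = laurentMatrix A e := by
    rw [hc'u, pullA_trivIdem, Matrix.one_mul, Matrix.mul_one]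
  refine ⟨ι', inferInstance, A, e, ?_, ?_⟩
  · have h := (⟨⟨_, _, c'.ext_mul_extInv, c'.extInv_mul_ext⟩, rfl⟩ : IsUnit c'.ext)
    rwa [c'.ext_of_triv, hu] at h
  · rw [← hu, ← bottClass_triv_eq c', hc', bottClass_triv_eq]; rfl

end GLLaurent

/-! ### From Laurent polynomials to polynomials -/

section LaurentToPoly

variable {n : ℕ} {ι' : Type} [Fintype ι']

/-- A shift making all exponents nonnegative. [folklore] -/
def laurentShift (e : ι' → ℤ) : ℕ := Finset.univ.sup fun i ↦ (-e i).toNat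

/-- Auxiliary statement for the surjectivity half of Bott periodicity. [folklore] -/
theorem le_laurentShift (e : ι' → ℤ) (i : ι') : 0 ≤ e i + laurentShift e := by
  have h : (-e i).toNat ≤ laurentShift e := Finset.le_sup (f := fun i ↦ (-e i).toNat) (Finset.mem_univ i)
  have h2 : -e i ≤ ((-e i).toNat : ℤ) := Int.self_le_toNat _
  omega

/-- A bound for the shifted degrees. [folklore] -/
def laurentDeg (e : ι' → ℤ) : ℕ := Finset.univ.sup fun i ↦ (e i + laurentShift e).toNat

/-- Auxiliary statement for the surjectivity half of Bott periodicity. [folklore] -/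
theorem toNat_lt_laurentDeg_succ (e : ι' → ℤ) (i : ι') : (e i + laurentShift e).toNat < laurentDeg e + 1 :=
  Nat.lt_succ_of_le (Finset.le_sup (f := fun i ↦ (e i + laurentShift e).toNat) (Finset.mem_univ i))

/-- The degree (in `Fin (d+1)`) of the shifted `i`-th monomial. [folklore] -/
def laurentIdx (e : ι' → ℤ) (i : ι') : Fin (laurentDeg e + 1) := ⟨(e i + laurentShift e).toNat, toNat_lt_laurentDeg_succ e i⟩

/-- **The polynomial coefficients** of `z^m · (∑ᵢ z^{eᵢ} Aᵢ)`: `a_k = ∑_{eᵢ + m = k} Aᵢ`. [cite: HusemollerFibreBundles1994, Ch. 11 Notation 5.1] -/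
def laurentCoeff (A : ι' → Matrix (Fin n) (Fin n) C(X, ℂ)) (e : ι' → ℤ) : Fin (laurentDeg e + 1) → Matrix (Fin n) (Fin n) C(X, ℂ) :=
  fun k ↦ ∑ i ∈ Finset.univ.filter (fun i ↦ laurentIdx e i = k), A i

omit [CompactSpace X] [T2Space X] [Fintype ι] [DecidableEq ι] in
/-- The shifted monomials are honest powers of `z`. [folklore] -/
theorem zA_pow_mul_zU_zpow (e : ι' → ℤ) (i : ι') :
    (zA : C(↥(pieceUp X ∩ pieceDn X), ℂ)) ^ laurentShift e * (((zU ^ (e i) : (C(↥(pieceUp X ∩ pieceDn X), ℂ))ˣ) : C(_, ℂ))) =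
      (zA : C(↥(pieceUp X ∩ pieceDn X), ℂ)) ^ ((laurentIdx e i : Fin _) : ℕ) := by
  have h1 : (zA : C(↥(pieceUp X ∩ pieceDn X), ℂ)) ^ laurentShift e =
      ((zU ^ (laurentShift e : ℤ) : (C(↥(pieceUp X ∩ pieceDn X), ℂ))ˣ) : C(↥(pieceUp X ∩ pieceDn X), ℂ)) := by
    rw [zpow_natCast, Units.val_pow_eq_pow_val]; rfl
  rw [h1, ← Units.val_mul, ← zpow_add, laurentIdx]
  simp only
  rw [show (laurentShift e : ℤ) + e i = ((e i + laurentShift e).toNat : ℕ) by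
    rw [Int.toNat_of_nonneg (le_laurentShift e i)]; ring, zpow_natCast, Units.val_pow_eq_pow_val]
  rfl

omit [CompactSpace X] [T2Space X] [Fintype ι] [DecidableEq ι] in
/-- **`z^m · (∑ᵢ z^{eᵢ} Aᵢ) = ∑ₖ zᵏ aₖ`** is a polynomial clutching matrix. [cite: HusemollerFibreBundles1994, Ch. 11 Notation 5.1] -/
theorem zA_pow_smul_laurentMatrix (A : ι' → Matrix (Fin n) (Fin n) C(X, ℂ)) (e : ι' → ℤ) :
    (zA : C(↥(pieceUp X ∩ pieceDn X), ℂ)) ^ laurentShift e • laurentMatrix A e = polyClutch (laurentCoeff A e) := by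
  ext p q : 1
  rw [Matrix.smul_apply, laurentMatrix_apply, smul_eq_mul, Finset.mul_sum, polyClutch, polyEval, Matrix.sum_apply]
  simp only [Matrix.smul_apply, smul_eq_mul, coeffA, Matrix.map_apply, laurentCoeff, Matrix.sum_apply, map_sum, Finset.mul_sum]
  rw [← Finset.sum_fiberwise (s := Finset.univ) (g := laurentIdx e)
    (f := fun i ↦ (zA : C(↥(pieceUp X ∩ pieceDn X), ℂ)) ^ laurentShift e *
      ((comapRingHom πA) (A i p q) * ((zU ^ e i : (C(↥(pieceUp X ∩ pieceDn X), ℂ))ˣ) : C(↥(pieceUp X ∩ pieceDn X), ℂ))))]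
  refine Finset.sum_congr rfl fun k _ ↦ Finset.sum_congr rfl fun i hi ↦ ?_
  rw [← (Finset.mem_filter.1 hi).2, mul_left_comm, zA_pow_mul_zU_zpow, mul_comm]

end LaurentToPoly

/-! ### The linearised clutching matrix is a linear clutching matrix over `X` -/

section CompLmat

variable {N m : ℕ}

omit [CompactSpace X] [T2Space X] [Fintype ι] [DecidableEq ι] in
/-- Auxiliary statement for the surjectivity half of Bott periodicity. [folklore] -/
theorem LmatA_map_coeffA (a : Fin (m + 1) → Matrix (Fin N) (Fin N) C(X, ℂ)) :
    LmatA (coeffA a) = (LmatA a).map (fun M' ↦ M'.map (comapRingHom (πA (X := X)))) := by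
  ext r c : 1
  simp only [LmatA, Matrix.map_apply, Matrix.of_apply]
  split_ifs
  · rfl
  · exact (Matrix.map_one _ (map_zero _) (map_one _)).symm
  · exact (Matrix.map_zero _ (map_zero _)).symm

omit [CompactSpace X] [T2Space X] [Fintype ι] [DecidableEq ι] in
/-- Auxiliary statement for the surjectivity half of Bott periodicity. [folklore] -/
theorem LmatB_map : LmatB m (Fin N) C(↥(pieceUp X ∩ pieceDn X), ℂ) = (LmatB m (Fin N) C(X, ℂ)).map (fun M' ↦ M'.map (comapRingHom (πA (X := X)))) := by
  ext r c : 1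
  simp only [LmatB, Matrix.map_apply, Matrix.of_apply]
  split_ifs
  · rw [Matrix.map_neg _ (map_neg _), Matrix.map_one _ (map_zero _) (map_one _)]
  · exact (Matrix.map_zero _ (map_zero _)).symm

variable (X) in
/-- The `z`-coefficient `B` of `Lᵐ(p) = A + z B`, over `X`, at the entry level. [cite: HusemollerFibreBundles1994, Ch. 11 Notation 3.1] -/
def linA (m N : ℕ) : Matrix (Fin (m + 1) × Fin N) (Fin (m + 1) × Fin N) C(X, ℂ) := Matrix.comp _ _ _ _ _ (LmatB m (Fin N) C(X, ℂ))

/-- The constant coefficient `A` of `Lᵐ(p) = A + z B`, over `X`, at the entry level. [cite: HusemollerFibreBundles1994, Ch. 11 Notation 3.1] -/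
def linB (a : Fin (m + 1) → Matrix (Fin N) (Fin N) C(X, ℂ)) : Matrix (Fin (m + 1) × Fin N) (Fin (m + 1) × Fin N) C(X, ℂ) :=
  Matrix.comp _ _ _ _ _ (LmatA a)

omit [CompactSpace X] [T2Space X] [Fintype ι] [DecidableEq ι] in
/-- **`Lᵐ(p)` at the entry level is the linear clutching matrix `z · linA + linB`.** [cite: HusemollerFibreBundles1994, Ch. 11 Notation 3.1] -/
theorem comp_Lmat_eq_linClutch (a : Fin (m + 1) → Matrix (Fin N) (Fin N) C(X, ℂ)) :
    Matrix.comp _ _ _ _ _ (Lmat (coeffA a) zA) = linClutch (linA X m N) (linB a) := by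
  have e1 : Matrix.comp _ _ _ _ _ (LmatA (coeffA a) + (zA : C(↥(pieceUp X ∩ pieceDn X), ℂ)) • LmatB m (Fin N) C(↥(pieceUp X ∩ pieceDn X), ℂ)) =
      Matrix.comp _ _ _ _ _ (LmatA (coeffA a)) + (zA : C(↥(pieceUp X ∩ pieceDn X), ℂ)) • Matrix.comp _ _ _ _ _ (LmatB m (Fin N) C(_, ℂ)) := rfl
  rw [Lmat_eq, e1, LmatA_map_coeffA, LmatB_map, Matrix.comp_map_map, Matrix.comp_map_map, linClutch]
  exact add_comm _ _

omit [CompactSpace X] [T2Space X] [Fintype ι] [DecidableEq ι] in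
/-- `linClutch` commutes with re-indexing. [folklore] -/
theorem reindex_linClutch {κ κ' : Type} [Fintype κ] [DecidableEq κ] [Fintype κ'] [DecidableEq κ'] (e : κ ≃ κ')
    (a b : Matrix κ κ C(X, ℂ)) : Matrix.reindex e e (linClutch a b) = linClutch (Matrix.reindex e e a) (Matrix.reindex e e b) := by
  simp only [linClutch, liftA, Matrix.reindex_apply, Matrix.submatrix_add, Matrix.submatrix_smul]
  rfl

omit [CompactSpace X] [T2Space X] [Fintype ι] [DecidableEq ι] in
/-- `Lᵐ(p)` at the entry level is a unit when `p` is. [cite: HusemollerFibreBundles1994, Ch. 11 Notation 3.1] -/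
theorem isUnit_comp_Lmat (a : Fin (m + 1) → Matrix (Fin N) (Fin N) C(X, ℂ)) (hp : IsUnit (polyClutch a)) :
    IsUnit (Matrix.comp _ _ _ _ _ (Lmat (coeffA a) zA)) := by
  have h := (isUnit_LtFamily a hp).map (comapRingHom (restrictMap (baseMap (sliceIncl 1))
    (mapsTo_inter (mapsTo_baseMap_pieceUp _) (mapsTo_baseMap_pieceDn _)))).mapMatrix
  rw [RingHom.mapMatrix_apply, LtFamily_slice] at h
  simpa [Lt_one] using h

end CompLmat

/-! ### The image of `Φ(α, β) = pr₁^*α + pr₁^*β · γ` -/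

section InPhi

/-- **`ξ` is in the image of the periodicity map** `Φ : K⁰(X) ⊕ K⁰(X) → K⁰(X × S²)`,
`Φ(α, β) = pr₁^*α + pr₁^*β · γ`. [cite: HusemollerFibreBundles1994, Ch. 11 Thm. 5.4] -/
def InPhi (ξ : K0 (X × S2r)) : Prop := ∃ α β : K0 X, ξ = pullback (prX X) α + pullback (prX X) β * bottγ X

namespace InPhi

/-- Auxiliary statement for the surjectivity half of Bott periodicity. [folklore] -/
theorem of_pullback (α : K0 X) : InPhi (pullback (prX X) α) := ⟨α, 0, by rw [map_zero, zero_mul, add_zero]⟩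

/-- Auxiliary statement for the surjectivity half of Bott periodicity. [folklore] -/
theorem zero : InPhi (0 : K0 (X × S2r)) := by simpa using of_pullback (X := X) 0

/-- Auxiliary statement for the surjectivity half of Bott periodicity. [folklore] -/
theorem one : InPhi (1 : K0 (X × S2r)) := by simpa [pullback_one] using of_pullback (X := X) 1

/-- Auxiliary statement for the surjectivity half of Bott periodicity. [folklore] -/
theorem _root_.Literature.AlgebraicTopology.KTheory.pullback_natCast' {Y Z : Type*} [TopologicalSpace Y] [TopologicalSpace Z]
    [CompactSpace Y] [T2Space Y] [CompactSpace Z] [T2Space Z] (f : C(Y, Z)) (k : ℕ) : pullback f (k : K0 Z) = k := by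
  induction k with
  | zero => simp
  | succ k ih => rw [Nat.cast_succ, map_add, ih, pullback_one, Nat.cast_succ]

/-- Auxiliary statement for the surjectivity half of Bott periodicity. [folklore] -/
theorem natCast (k : ℕ) : InPhi (k : K0 (X × S2r)) := by
  have := of_pullback (X := X) (k : K0 X)
  rwa [pullback_natCast'] at this

/-- Auxiliary statement for the surjectivity half of Bott periodicity. [folklore] -/
theorem gamma : InPhi (bottγ X) := ⟨0, 1, by rw [map_zero, pullback_one, one_mul, zero_add]⟩

/-- Auxiliary statement for the surjectivity half of Bott periodicity. [folklore] -/
theorem add {ξ ξ' : K0 (X × S2r)} (h : InPhi ξ) (h' : InPhi ξ') : InPhi (ξ + ξ') := by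
  obtain ⟨α, β, rfl⟩ := h
  obtain ⟨α', β', rfl⟩ := h'
  exact ⟨α + α', β + β', by rw [map_add, map_add]; ring⟩

/-- Auxiliary statement for the surjectivity half of Bott periodicity. [folklore] -/
theorem neg {ξ : K0 (X × S2r)} (h : InPhi ξ) : InPhi (-ξ) := by
  obtain ⟨α, β, rfl⟩ := h
  exact ⟨-α, -β, by rw [map_neg, map_neg]; ring⟩

/-- Auxiliary statement for the surjectivity half of Bott periodicity. [folklore] -/
theorem sub {ξ ξ' : K0 (X × S2r)} (h : InPhi ξ) (h' : InPhi ξ') : InPhi (ξ - ξ') := by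
  rw [sub_eq_add_neg]; exact h.add h'.neg

/-- Auxiliary statement for the surjectivity half of Bott periodicity. [folklore] -/
theorem mul {ξ ξ' : K0 (X × S2r)} (h : InPhi ξ) (h' : InPhi ξ') : InPhi (ξ * ξ') := by
  obtain ⟨α, β, rfl⟩ := h
  obtain ⟨α', β', rfl⟩ := h'
  have hγ : bottγ X * bottγ X = bottγ X + bottγ X - 1 := by
    have := bottγ_sq_add_one (X := X); rw [sq, two_mul] at this; linear_combination this
  refine ⟨α * α' - β * β', α * β' + β * α' + (β * β' + β * β'), ?_⟩
  simp only [map_sub, map_add, pullback_mul]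
  linear_combination (pullback (prX X) β * pullback (prX X) β') * hγ

/-- Auxiliary statement for the surjectivity half of Bott periodicity. [folklore] -/
theorem pow {ξ : K0 (X × S2r)} (h : InPhi ξ) (k : ℕ) : InPhi (ξ ^ k) := by
  induction k with
  | zero => rw [pow_zero]; exact one
  | succ k ih => rw [pow_succ]; exact ih.mul h

/-- Auxiliary statement for the surjectivity half of Bott periodicity. [folklore] -/
theorem eta : InPhi (bottη X) := by rw [bottη_eq]; exact (natCast 2).sub gamma

end InPhi

end InPhi

/-! ### Surjectivity of the periodicity map -/

section Surjective

variable {N m n : ℕ}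

/-- (S1) Invertible linear clutching matrices have classes in the image of `Φ`. [cite: HusemollerFibreBundles1994, Ch. 11 Thm. 5.4] -/
theorem InPhi.of_linClutch (a b : Matrix (Fin n) (Fin n) C(X, ℂ)) (hg : IsUnit (linClutch a b)) : InPhi (bottClassGL (linClutch a b)) := by
  rw [bottClassGL_linClutch a b hg, bottClass_zClutch]
  exact ((InPhi.of_pullback _).mul InPhi.gamma).add (InPhi.of_pullback _)

/-- (S2) Invertible polynomial clutching matrices have classes in the image of `Φ` (linearisation). [cite: HusemollerFibreBundles1994, Ch. 11 Thm. 5.4] -/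
theorem InPhi.of_polyClutch (a : Fin (m + 1) → Matrix (Fin N) (Fin N) C(X, ℂ)) (hp : IsUnit (polyClutch a)) :
    InPhi (bottClassGL (polyClutch a)) := by
  have h := bottClassGL_comp_Lmat a hp
  have hL : InPhi (bottClassGL (Matrix.comp _ _ _ _ _ (Lmat (coeffA a) zA))) := by
    rw [← bottClassGL_reindex _ finProdFinEquiv, comp_Lmat_eq_linClutch, reindex_linClutch]
    refine InPhi.of_linClutch _ _ ?_
    rw [← reindex_linClutch, ← comp_Lmat_eq_linClutch]
    exact (isUnit_comp_Lmat a hp).map (Matrix.reindexAlgEquiv ℂ _ finProdFinEquiv)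
  have : bottClassGL (polyClutch a) = bottClassGL (Matrix.comp _ _ _ _ _ (Lmat (coeffA a) zA)) - (m * Fintype.card (Fin N) : ℕ) := by
    rw [h]; abel
  rw [this]; exact hL.sub (InPhi.natCast _)

/-- (S3) Invertible Laurent polynomial clutching matrices have classes in the image of `Φ`. [cite: HusemollerFibreBundles1994, Ch. 11 Thm. 5.4] -/
theorem InPhi.of_laurent {ι' : Type} [Fintype ι'] (A : ι' → Matrix (Fin n) (Fin n) C(X, ℂ)) (e : ι' → ℤ) (hL : IsUnit (laurentMatrix A e)) :
    InPhi (bottClassGL (laurentMatrix A e)) := by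
  have hsmul := bottClassGL_zA_pow_smul (laurentShift e) _ hL
  rw [zA_pow_smul_laurentMatrix] at hsmul
  have hpu : IsUnit (polyClutch (laurentCoeff A e)) := by
    rw [← zA_pow_smul_laurentMatrix]; exact isUnit_smul_of_isUnit (isUnit_zA.pow _) hL
  have hp := InPhi.of_polyClutch _ hpu
  have key : bottClassGL (laurentMatrix A e) = bottClassGL (polyClutch (laurentCoeff A e)) * bottη X ^ laurentShift e := by
    rw [hsmul, mul_assoc, ← mul_pow, bottγ_mul_bottη, one_pow, mul_one]
  rw [key]; exact hp.mul (InPhi.eta.pow _)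

/-- (S4) **Every invertible clutching matrix has class in the image of `Φ`.** [cite: HusemollerFibreBundles1994, Ch. 11 Thm. 5.4] -/
theorem InPhi.of_bottClassGL (g : Matrix (Fin n) (Fin n) C(↥(pieceUp X ∩ pieceDn X), ℂ)) (hg : IsUnit g) : InPhi (bottClassGL g) := by
  obtain ⟨ι', _, A, e, hL, h⟩ := exists_laurentMatrix_bottClassGL_eq g hg
  rw [h]; exact InPhi.of_laurent A e hL

/-- (S5) **Every class of an idempotent over `X × S²` is in the image of `Φ`.** [cite: HusemollerFibreBundles1994, Ch. 11 Thm. 5.4] -/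
theorem InPhi.of_idem (P : Idem C(X × S2r, ℂ)) : InPhi (KZero.of P) := by
  obtain ⟨c, hc⟩ := exists_of_eq_bottClass P
  have h := bottClass_add_pullback_compl c
  have hu : IsUnit c.ext := ⟨⟨_, _, c.ext_mul_extInv, c.extInv_mul_ext⟩, rfl⟩
  have h' : bottClass _ c = bottClassGL c.ext - pullback (prX X) (KZero.of (P.map (comapRingHom sX)).compl) := by
    rw [← h]; abel
  rw [hc, h']
  exact (InPhi.of_bottClassGL _ hu).sub (InPhi.of_pullback _)

/-- **Bott periodicity, surjectivity half** (Husemöller, *Fibre Bundles*, Ch. 11 Thm. 5.4 / Cor. 5.5):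
every element of `K⁰(X × S²)` has the form `pr₁^*α + pr₁^*β · γ` with `α, β ∈ K⁰(X)` and
`γ = [θ¹, z]`. [cite: HusemollerFibreBundles1994, Ch. 11 Thm. 5.4] -/
theorem bott_surjective (ξ : K0 (X × S2r)) : ∃ α β : K0 X, ξ = pullback (prX X) α + pullback (prX X) β * bottγ X := by
  obtain ⟨p, q, rfl⟩ := KZero.exists_of_sub_of ξ
  exact (InPhi.of_idem p).sub (InPhi.of_idem q)

end Surjective

end Literature.AlgebraicTopology.KTheory

end
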